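import Summits.QuantumFields.YangMills.Theorems.BalabanUVNodesK2NamedJetsKKeyed

/-!
# Crux K2⁷ `EndpointGivenBR13SepCoPH` (stmt-QuantumFields-20543) — THE TWO REGISTERED STUB TEXTS OF SKELETON v6 AS TREE DEFINITIONS
# (`RunRemAtSomeJets` 2ᴮ″, `D1AtAnchoredJets` 1ᴬ, with the crux's `Window13`), so that stub proofs can be filed BY NAME; the by-name
# composition to the crux decl; and the definer's USE FORMS for the (D1) stub (switch-κ and κ-free corner forms)

Cell `ym-nodeO-ideate`, DEFINER seat `ym-nodeO-def-1` (gen 5; director-ym R361 ∕ №21).  `--kind definition --supports stmt-QuantumFields-20543 --as helper`;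
count-neutral.  [I] = [Balaban1987RG1] Commun. Math. Phys. **109** (1987); [II] = [Balaban1988RG2Cluster] Commun. Math. Phys. **119** (1988).

WHY.  Plan g82 registered skeleton v6 (sha16 `5a75a2378c79b303`, desk `pub-ymgap-plan/D82-K2V6/K2Skeleton13SepCoPHv6.lean`, namespace
`…Theses.BalabanUVNodes.K2Skeleton13SepCoPH`, 2026-08-28T02:32:34Z) on K2⁷ with the two stubs `stub_d1AnchoredJets13 : D1AtAnchoredJets` (1ᴬ, L; DEALT to the
β sub-cell ∕ b2b (D1) desks and to the seats `ym-nodeO-d1-w1∕w2`, dag-lead GATE v1.57 ∕ WIDTH-207) and `stub_runRemNamedJets13 : RunRemAtSomeJets` (2ᴮ″, XL; NODE O).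
The gate credits a `--supports stmt-QuantumFields-20543` proof only if it proves a registered stub BY NAME with that VERBATIM header; the two texts are `def`s
LOCAL to the skeleton file, which lives in the plan's desk and is never imported (the tree stays sorry-free) — so no tree file can spell `theorem
stub_d1AnchoredJets13 : D1AtAnchoredJets`.  THIS FILE puts the two texts (and the window predicate they read) into the tree BYTE-FOR-BYTE as in v6
(:241–242, :319–322, :330–334 of the registered file; the letters `RunRemAt` p596574, `ScaleAnchor` p593586, `beta0OfJs` ∕ `StepColourData` p588621 are this
seat's and are imported BY NAME), exactly as `BalabanUVNodesK0V19Defs` does for K0⁷ V19.  §2 composes the crux decl BY NAME from the two texts (the skeleton's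
`EndpointGivenBR13SepCoPH_of_anchoredJetsRun`; = the tree's K-keyed concluder `…KKeyed.EndpointGivenBR13SepCoPH_of_anchorKeyedK_runShadowingJetsK`, whose
inline hypotheses ARE these texts with `Window13` unfolded).  §3 records, for the (D1) suppliers, what 1ᴬ asks ONCE the identification clause is read:
all colour data anchoring ONE tuple share their named numbers (`ScaleAnchor.eq_of_smul`, `0 < θ.cβ` from admissibility), so the drift may be proved at ANY ONE
anchoring κ₀ per tuple (switch-κ form), and 1ᴬ is implied by — and, at tuples where some named jets anchor, equivalent to — the κ-FREE corner statement
«whatever sequence `b` anchors the record's β scale by scale drifts with slope `θ.cβ · stepBal 2 F.L`» (no `JsOfRecord`, no (P6) datum in that statement).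

CONTENTS (3 `def` + 11 theorems; 0 `sorry`; [folklore] bookkeeping BY NAME; no `instance`, no `notation`, no `axiom`):
* §1 `Window13 F θ hP` · `RunRemAtSomeJets` · `D1AtAnchoredJets` — v6 texts VERBATIM (docstrings = the skeleton's, abridged).
* §2 `window13_iff` (`Iff.rfl` against the crux's inline window) · `runRemAtSomeJets_iff_inline` ∕ `d1AtAnchoredJets_iff_inline` (`Iff.rfl` against the K-keyed
  INLINE texts of `…KKeyed`, so every tree road concluding an inline text closes the named stub by `exact`) · ★ `EndpointGivenBR13SepCoPH_of_stubTexts`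
  (1ᴬ → 2ᴮ″ → the crux decl BY NAME).
* §3 use forms for 1ᴬ: `d1AtAnchoredJets_of_drift_of_anchor` (the anchored (D1) theorem keyed on admissibility alone ⟹ 1ᴬ; hypothesis = p593586 ∕ p596574's use
  form) · ★ `d1AtAnchoredJets_of_someAnchoredDrift` (switch-κ) · ★ `d1AtAnchoredJets_of_cornerDrift` (κ-free corner drift ⟹ 1ᴬ) · `cornerDrift_of_d1AtAnchoredJets`
  (converse at anchored tuples) ; bridges for 2ᴮ″: `runRemAtSomeJets_of_admKeyed` ((B)-free, admissible-keyed run text ⟹ 2ᴮ″ — «2ʳ» of P3 g51 n°87) ·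
  `runRemAtSomeJets_of_givenB` (p596574's 2ᴮ″-given-(B) text ⟹ 2ᴮ″) · `runRemAtSomeJets_of_remAtAdm` (v4's box text ⟹ 2ᴮ″).

HONEST FRAMING.  Definitions and elementary bookkeeping; NOTHING of Bałaban's analysis is asserted; no stub is proved here; K2⁷ stmt-QuantumFields-20543 OPEN
(v6: 2 registered stubs, 0 closed); the skeleton of record is the plan's v6 (this file neither replaces nor re-registers it — it mirrors its texts so that proofs can
be filed by name; if the plan re-cuts, this file is superseded, not edited); (P6) — the value of κ — and the sub-cell constant `c⋆` NOT decided; counts unmoved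
(typed 28∕28 · discharged 5∕27).  [I] Thm 2 + (0.31) p. 259 (NODE O) is UNPROVED IN PRINT.  One finite 𝕋⁴ programme at fixed `ε = L^{−K}` — route R4 closes the
CONDITIONAL finite-𝕋⁴ rung `BalabanLadder.UV` only: NOT the continuum limit, NOT ℝ⁴, NOT OS, NOT a mass gap, NOT Clay; the Yang–Mills mass gap is NOT proved
by any of this.  Sources (context only): [I] Thm 2 p. 259 (first sentence), (1.3) p. 260, (1.20)–(1.22) p. 264, Thm 3 p. 264, (2.12)–(2.14) p. 268, (5.10) p. 293;
[II] Lemma 3 (2.38) p. 20, (2.41) p. 21.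
-/

noncomputable section

namespace Summit.QuantumFields.YangMills.Theorems.BalabanUVNodesK2V6Defs

open Literature.MathematicalPhysics.QuantumFieldTheory.Balaban1983to89
open Literature.MathematicalPhysics.QuantumFieldTheory.Balaban1983to89.DagBinding (EndpointExistence)
open Literature.MathematicalPhysics.QuantumFieldTheory.Balaban1983to89.T4Continuum (T4Family)
open Literature.MathematicalPhysics.QuantumFieldTheory.Balaban1983to89.Beta.Drift (OneLoopDrift)
open Summit.QuantumFields.YangMills.Theorems.BalabanUVNodesK2JsOfRecord (StepColourData JsOfRecord beta0OfJs)
open Summit.QuantumFields.YangMills.Theorems.BalabanUVNodesK2NamedJetsRemAt (RemAt ConstRemainder ScaleAnchor)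
open Summit.QuantumFields.YangMills.Theorems.BalabanUVNodesK2NamedJetsRunRemAt (RunRemAt RunConstRemainder SurvCont runRemAt_of_remAt
  endpointExistence_of_runRemAt_drift)
open Summit.QuantumFields.YangMills.Theorems.EndpointGivenBR13SepCoPH.Negative.RemNamedJets13FalseOfTwoNormalisations (oneLoopDrift_const_mul)

/-! ## §1 The window predicate and the two registered v6 stub texts, verbatim -/

/-- K2⁷'s WINDOW hypothesis at `(F, θ, hP)`, VERBATIM from the crux text (v5∕v6: part of every stub's prefix; = v6 :241–242). [folklore] -/
def Window13 (F : T4Family) (θ : Node00.Stage13HParams F 2) (hP : θ.Provisos₁₃SepCoPH F 2) : Prop :=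
  ∃ γ₁ : ℝ, 0 < γ₁ ∧ ∀ γ : ℝ, 0 < γ → γ ≤ γ₁ → ∃ P : B12.RunParams, 1 ≤ P.K ∧ ((Node00.datumOfRecord₁₃SepCoPH F 2 θ hP).C P).flow.InInterval γ P.K

/-- **STUB 2ᴮ″ TEXT (v6 :319–322 VERBATIM; THE REGISTERED (D4)∧(C) TEXT OF LINE 1′, `stub_runRemNamedJets13 : RunRemAtSomeJets`)** «rows (D4) ∧ B4 read ALONG THE
IN-WINDOW RG RUNS of the tuple's own construction — constant remainder `|β_{k+1}(g_0,…,g_k) − θ.cβ·b_k| ≤ s` with the cap `s ≤ θ.cβ·stepBal 2 F.L` at every prefix of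
every solution of (0.20) staying in `]0, γ₀]`, the per-scale ANCHOR kept box-wise (identification clause), (C) on the SURVIVOR sets — GIVEN the unity guard,
admissibility, (B) and the window AT THE TUPLE; κ chosen AFTER θ»: `∃ κ, RunRemAt F κ θ hP θ.cβ` (the RUN letter, p596574 :175).  HYPOTHESIS SHAPE ∕ obligation text,
never a fact; size XL (wall = NODE O, [I] Thm 2 p. 259 unproved in print; instance 0∕1). [folklore] -/
def RunRemAtSomeJets : Prop :=
  ∀ (F : T4Family) (θ : Node00.Stage13HParams F 2) (hP : θ.Provisos₁₃SepCoPH F 2), (θ.ZhUnity F 2 ∧ θ.SlotsNondegenerate₁₃ F 2) → θ.Admissible F 2 →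
    B16.EndStatementBPrinted (Node00.datumOfRecord₁₃SepCoPH F 2 θ hP).C → Window13 F θ hP →
    ∃ κ : StepColourData, RunRemAt F κ θ hP θ.cβ

/-- **STUB 1ᴬ TEXT (v6 :330–334 VERBATIM; THE (D1) STUB, ANCHOR-KEYED, `stub_d1AnchoredJets13 : D1AtAnchoredJets`)** «row (D1) at the record, carried by the
ANCHORING named jets»: at a tuple carrying the crux's hypotheses, whenever a colour datum's `θ.cβ`-scaled named one-loop numbers ANCHOR the record's β scale by
scale (`ScaleAnchor`, the identification clause common to `RemAt` and `RunRemAt`), the BARE numbers drift with slope `stepBal 2 F.L` (= `D1Drift F.L (JsOfRecord F κ) 2 0 1`,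
`BalabanUVNodesK2JsOfRecord.d1Drift_JsOfRecord_iff`).  HYPOTHESIS SHAPE ∕ obligation text, never a fact; size L (+ transfer: (D1) is ONE quartic equation in the colour
data, `Gaps.D1WardNoFreeKnob.d1Drift_iff_wardNoFreeKnob` — «(D1) at EVERY κ» is NOT a road; see §3 for what the anchor buys). [folklore] -/
def D1AtAnchoredJets : Prop :=
  ∀ (F : T4Family) (κ : StepColourData) (θ : Node00.Stage13HParams F 2) (hP : θ.Provisos₁₃SepCoPH F 2), (θ.ZhUnity F 2 ∧ θ.SlotsNondegenerate₁₃ F 2) → θ.Admissible F 2 →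
    B16.EndStatementBPrinted (Node00.datumOfRecord₁₃SepCoPH F 2 θ hP).C → Window13 F θ hP →
    ScaleAnchor (Node00.datumOfRecord₁₃SepCoPH F 2 θ hP).βfun (fun k => θ.cβ * beta0OfJs F κ k) →
    ∃ A : ℝ, OneLoopDrift (B12Normalization.stepBal 2 F.L) A (beta0OfJs F κ)

/-! ## §2 Sanity (`Iff.rfl`) and the by-name composition to the crux decl -/

/-- `Window13 F θ hP` IS the crux decl's inline window hypothesis (`Iff.rfl`). [folklore] -/
theorem window13_iff (F : T4Family) (θ : Node00.Stage13HParams F 2) (hP : θ.Provisos₁₃SepCoPH F 2) :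
    Window13 F θ hP ↔
      ∃ γ₁ : ℝ, 0 < γ₁ ∧ ∀ γ : ℝ, 0 < γ → γ ≤ γ₁ →
        ∃ P : B12.RunParams, 1 ≤ P.K ∧ ((Node00.datumOfRecord₁₃SepCoPH F 2 θ hP).C P).flow.InInterval γ P.K :=
  Iff.rfl

/-- 2ᴮ″ IS the K-keyed INLINE run text of `…KKeyed` (hypothesis `h₂` of `EndpointGivenBR13SepCoPH_of_anchorKeyedK_runShadowingJetsK`), `Iff.rfl` — so a tree road whose
conclusion is that inline text (e.g. `…K2CornerRoad.runRemAtSomeJetsK_of_u3K_anchorK`, `…N17RunRemAtOfShiftAnchor.runRemAtSomeJets_of_n17AtRecord13_anchorSurv`) closes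
`stub_runRemNamedJets13 : RunRemAtSomeJets` by `exact`. [folklore] -/
theorem runRemAtSomeJets_iff_inline :
    RunRemAtSomeJets ↔
      ∀ (F : T4Family) (θ : Node00.Stage13HParams F 2) (hP : θ.Provisos₁₃SepCoPH F 2),
        (θ.ZhUnity F 2 ∧ θ.SlotsNondegenerate₁₃ F 2) → θ.Admissible F 2 →
        B16.EndStatementBPrinted (Node00.datumOfRecord₁₃SepCoPH F 2 θ hP).C →
        (∃ γ₁ : ℝ, 0 < γ₁ ∧ ∀ γ : ℝ, 0 < γ → γ ≤ γ₁ →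
          ∃ P : B12.RunParams, 1 ≤ P.K ∧ ((Node00.datumOfRecord₁₃SepCoPH F 2 θ hP).C P).flow.InInterval γ P.K) →
        ∃ κ : StepColourData, RunRemAt F κ θ hP θ.cβ :=
  Iff.rfl

/-- 1ᴬ IS the K-keyed INLINE anchored-(D1) text of `…KKeyed` (hypothesis `hD1` of `EndpointGivenBR13SepCoPH_of_anchorKeyedK_runShadowingJetsK`), `Iff.rfl`. [folklore] -/
theorem d1AtAnchoredJets_iff_inline :
    D1AtAnchoredJets ↔
      ∀ (F : T4Family) (κ : StepColourData) (θ : Node00.Stage13HParams F 2) (hP : θ.Provisos₁₃SepCoPH F 2),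
        (θ.ZhUnity F 2 ∧ θ.SlotsNondegenerate₁₃ F 2) → θ.Admissible F 2 →
        B16.EndStatementBPrinted (Node00.datumOfRecord₁₃SepCoPH F 2 θ hP).C →
        (∃ γ₁ : ℝ, 0 < γ₁ ∧ ∀ γ : ℝ, 0 < γ → γ ≤ γ₁ →
          ∃ P : B12.RunParams, 1 ≤ P.K ∧ ((Node00.datumOfRecord₁₃SepCoPH F 2 θ hP).C P).flow.InInterval γ P.K) →
        ScaleAnchor (Node00.datumOfRecord₁₃SepCoPH F 2 θ hP).βfun (fun k => θ.cβ * beta0OfJs F κ k) →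
        ∃ A : ℝ, OneLoopDrift (B12Normalization.stepBal 2 F.L) A (beta0OfJs F κ) :=
  Iff.rfl

/-- **★ THE BY-NAME COMPOSITION (kernel-checked, no sorry): 1ᴬ → 2ᴮ″ → THE CRUX DECL BY NAME** (`Summit.QuantumFields.YangMills.Theses.BalabanUVNodes.EndpointGivenBR13SepCoPH`,
route rev 25) — POINTWISE, exactly as the registered skeleton's `EndpointGivenBR13SepCoPH_of_anchoredJetsRun`: per tuple, κ from 2ᴮ″ (which CONSUMES the unity guard, admissibility,
(B) and the window), its ANCHOR conjunct feeds 1ᴬ for the bare drift, and the tree's `endpointExistence_of_runRemAt_drift` (p596574 :213: drift rescaled by `θ.cβ` + the run-wise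
END of `Gaps.EndSurvivorCensus`) concludes.  (= `…KKeyed.EndpointGivenBR13SepCoPH_of_anchorKeyedK_runShadowingJetsK` on the unfolded texts.)  So once BOTH stubs land by name,
`EndpointGivenBR13SepCoPH_of_stubTexts stub_d1AnchoredJets13 stub_runRemNamedJets13` is the sorry-free assembly.  CONDITIONAL on the two displayed texts; K2⁷ NOT closed;
nothing of Bałaban asserted. [cite: Balaban1987RG1, Thm 2 p.259 (first sentence), (5.10) p.293 and (2.12)–(2.14) p.268] -/
theorem EndpointGivenBR13SepCoPH_of_stubTexts (h₁ : D1AtAnchoredJets) (h₂ : RunRemAtSomeJets) :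
    Summit.QuantumFields.YangMills.Theses.BalabanUVNodes.EndpointGivenBR13SepCoPH := by
  intro F θ hP hU hθ hB hwin
  obtain ⟨κ, hRun⟩ := h₂ F θ hP hU hθ hB hwin
  have hanch := hRun
  obtain ⟨-, -, -, -, -, -, hanch, -⟩ := hanch
  obtain ⟨A, hdrift⟩ := h₁ F κ θ hP hU hθ hB hwin hanch
  exact endpointExistence_of_runRemAt_drift F κ θ hP hRun hdrift

/-! ## §3 Use forms for the suppliers of 1ᴬ (switch-κ; κ-free corner form) and bridges into 2ᴮ″

All colour data anchoring ONE tuple at the scale `θ.cβ ≠ 0` have the SAME named one-loop numbers (`ScaleAnchor.eq_of_smul`; `0 < θ.cβ` is Stage-9 admissibility's chart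
clause, `hθ.toStage9.chart.1`, as in `beta0OfJs_eq_of_remAt_adm` ∕ `beta0OfJs_eq_of_runRemAt_adm`).  Hence (i) the drift conclusion of 1ᴬ may be established at ANY ONE
anchoring κ₀ per tuple and transported; (ii) 1ᴬ follows from the κ-FREE statement that the (unique) sequence anchoring the record's β drifts with slope
`θ.cβ · stepBal 2 F.L` (`oneLoopDrift_const_mul` by `θ.cβ⁻¹`), and conversely gives it back at every tuple where some named jets anchor. -/

/-- USE FORM (anchored, keyed on admissibility alone): the (D1) drift for every colour datum whose `θ.cβ`-scaled numbers ANCHOR an admissible proviso'd record ⟹ 1ᴬ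
(the extra antecedents of the registered text are discarded).  Hypothesis VERBATIM = that of the tree's use forms `…K2NamedJetsRemAt.d1AtShadowingJets_of_drift_of_anchor`
(p593586) ∕ `…K2NamedJetsRunRemAt.d1AtRunShadowingJets_of_drift_of_anchor` (p596574) ∕ `…KKeyed.d1AtShadowingJetsK_of_anchorKeyedK`'s `h`. [folklore] -/
theorem d1AtAnchoredJets_of_drift_of_anchor
    (h : ∀ (F : T4Family) (κ : StepColourData) (θ : Node00.Stage13HParams F 2) (hP : θ.Provisos₁₃SepCoPH F 2), θ.Admissible F 2 →
      ScaleAnchor (Node00.datumOfRecord₁₃SepCoPH F 2 θ hP).βfun (fun k => θ.cβ * beta0OfJs F κ k) →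
      ∃ A : ℝ, OneLoopDrift (B12Normalization.stepBal 2 F.L) A (beta0OfJs F κ)) :
    D1AtAnchoredJets :=
  fun F κ θ hP _ hθ _ _ hanch => h F κ θ hP hθ hanch

/-- **★ USE FORM «SWITCH κ»**: to prove 1ᴬ it suffices, at every tuple carrying the crux's hypotheses AT WHICH SOME colour datum anchors the record, to exhibit ONE anchoring
colour datum `κ₀` whose bare numbers drift with slope `stepBal 2 F.L` — every other anchoring κ has the same numbers (`ScaleAnchor.eq_of_smul` at `θ.cβ ≠ 0`).  (So a (D1)
theorem for ONE convenient family of named jets — e.g. a pinned (P6) datum — discharges 1ᴬ as soon as THAT datum is known to anchor the record; «(D1) at every κ» is never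
asked.) [folklore] -/
theorem d1AtAnchoredJets_of_someAnchoredDrift
    (h : ∀ (F : T4Family) (θ : Node00.Stage13HParams F 2) (hP : θ.Provisos₁₃SepCoPH F 2), (θ.ZhUnity F 2 ∧ θ.SlotsNondegenerate₁₃ F 2) → θ.Admissible F 2 →
      B16.EndStatementBPrinted (Node00.datumOfRecord₁₃SepCoPH F 2 θ hP).C → Window13 F θ hP →
      (∃ κ : StepColourData, ScaleAnchor (Node00.datumOfRecord₁₃SepCoPH F 2 θ hP).βfun (fun k => θ.cβ * beta0OfJs F κ k)) →
      ∃ (κ₀ : StepColourData) (A : ℝ), ScaleAnchor (Node00.datumOfRecord₁₃SepCoPH F 2 θ hP).βfun (fun k => θ.cβ * beta0OfJs F κ₀ k) ∧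
        OneLoopDrift (B12Normalization.stepBal 2 F.L) A (beta0OfJs F κ₀)) :
    D1AtAnchoredJets := by
  intro F κ θ hP hU hθ hB hwin hanch
  obtain ⟨κ₀, A, hanch₀, hdrift₀⟩ := h F θ hP hU hθ hB hwin ⟨κ, hanch⟩
  have hκ : beta0OfJs F κ = beta0OfJs F κ₀ := hanch.eq_of_smul (ne_of_gt hθ.toStage9.chart.1) hanch₀
  exact ⟨A, hκ ▸ hdrift₀⟩

/-- **★ USE FORM «κ-FREE CORNER DRIFT»**: 1ᴬ follows from the statement, about the RECORD ALONE (no named jets, no (P6) datum), that at every tuple carrying the crux's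
hypotheses EVERY sequence `b` anchoring the record's β scale by scale (`ScaleAnchor (datum).βfun b` — there is at most one, `ScaleAnchor.eq`) drifts with the SCALED slope:
`∃ A, OneLoopDrift (θ.cβ · stepBal 2 F.L) A b` — «row (D1) read on the record's own zero-corner numbers» ([I] (1.3) p. 260, (2.12)–(2.13) p. 268; the cumulative-drift form is the
cell's (T-drift), located as NOT in print).  Proof: instantiate at `b := θ.cβ • beta0OfJs F κ` and divide the drift by `θ.cβ > 0` (`oneLoopDrift_const_mul θ.cβ⁻¹`). [folklore] -/
theorem d1AtAnchoredJets_of_cornerDrift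
    (h : ∀ (F : T4Family) (θ : Node00.Stage13HParams F 2) (hP : θ.Provisos₁₃SepCoPH F 2), (θ.ZhUnity F 2 ∧ θ.SlotsNondegenerate₁₃ F 2) → θ.Admissible F 2 →
      B16.EndStatementBPrinted (Node00.datumOfRecord₁₃SepCoPH F 2 θ hP).C → Window13 F θ hP →
      ∀ b : ℕ → ℝ, ScaleAnchor (Node00.datumOfRecord₁₃SepCoPH F 2 θ hP).βfun b →
        ∃ A : ℝ, OneLoopDrift (θ.cβ * B12Normalization.stepBal 2 F.L) A b) :
    D1AtAnchoredJets := by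
  intro F κ θ hP hU hθ hB hwin hanch
  obtain ⟨A, hd⟩ := h F θ hP hU hθ hB hwin _ hanch
  have hcβ : 0 < θ.cβ := hθ.toStage9.chart.1
  refine ⟨|θ.cβ⁻¹| * A, ?_⟩
  have h' := oneLoopDrift_const_mul hd θ.cβ⁻¹
  have e1 : θ.cβ⁻¹ * (θ.cβ * B12Normalization.stepBal 2 (F.L : ℝ)) = B12Normalization.stepBal 2 (F.L : ℝ) := by
    rw [← mul_assoc, inv_mul_cancel₀ hcβ.ne', one_mul]
  have e2 : (fun j => θ.cβ⁻¹ * (θ.cβ * beta0OfJs F κ j)) = beta0OfJs F κ := by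
    funext j
    rw [← mul_assoc, inv_mul_cancel₀ hcβ.ne', one_mul]
  rw [e1, e2] at h'
  exact h'

/-- CONVERSE AT ANCHORED TUPLES: 1ᴬ gives the κ-free corner drift back at every tuple carrying the crux's hypotheses at which SOME colour datum's scaled numbers anchor the
record (which is what 2ᴮ″ supplies per tuple): the anchoring sequence is then `θ.cβ • beta0OfJs F κ` (`ScaleAnchor.eq`) and the bare drift rescales by `θ.cβ`
(`oneLoopDrift_const_mul`).  So, jointly with 2ᴮ″, the κ-free corner form and 1ᴬ are the SAME obligation. [folklore] -/
theorem cornerDrift_of_d1AtAnchoredJets (h : D1AtAnchoredJets) :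
    ∀ (F : T4Family) (θ : Node00.Stage13HParams F 2) (hP : θ.Provisos₁₃SepCoPH F 2), (θ.ZhUnity F 2 ∧ θ.SlotsNondegenerate₁₃ F 2) → θ.Admissible F 2 →
      B16.EndStatementBPrinted (Node00.datumOfRecord₁₃SepCoPH F 2 θ hP).C → Window13 F θ hP →
      (∃ κ : StepColourData, ScaleAnchor (Node00.datumOfRecord₁₃SepCoPH F 2 θ hP).βfun (fun k => θ.cβ * beta0OfJs F κ k)) →
      ∀ b : ℕ → ℝ, ScaleAnchor (Node00.datumOfRecord₁₃SepCoPH F 2 θ hP).βfun b →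
        ∃ A : ℝ, OneLoopDrift (θ.cβ * B12Normalization.stepBal 2 F.L) A b := by
  intro F θ hP hU hθ hB hwin hκ b hb
  obtain ⟨κ, hanch⟩ := hκ
  obtain ⟨A, hdrift⟩ := h F κ θ hP hU hθ hB hwin hanch
  have hbκ : b = fun k => θ.cβ * beta0OfJs F κ k := hb.eq hanch
  refine ⟨|θ.cβ| * A, ?_⟩
  rw [hbκ]
  exact oneLoopDrift_const_mul hdrift θ.cβ

/-- BRIDGE «2ʳ ⟹ 2ᴮ″»: the (B)-FREE, window-free, admissible-keyed run text `∀ F θ hP, θ.Admissible F 2 → ∃ κ, RunRemAt F κ θ hP θ.cβ` (P3 g51's «2ʳ», evidence n°87 on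
stmt-QuantumFields-20543: the currency that pays K1⁷ AND K2⁷ once) ⟹ the registered 2ᴮ″ (the extra antecedents are discarded). [folklore] -/
theorem runRemAtSomeJets_of_admKeyed
    (h : ∀ (F : T4Family) (θ : Node00.Stage13HParams F 2) (hP : θ.Provisos₁₃SepCoPH F 2), θ.Admissible F 2 →
      ∃ κ : StepColourData, RunRemAt F κ θ hP θ.cβ) :
    RunRemAtSomeJets :=
  fun F θ hP _ hθ _ _ => h F θ hP hθ

/-- BRIDGE «2ᴮ″-given-(B) ⟹ 2ᴮ″»: p596574's run text keyed on the unity guard, admissibility and (B) (hypothesis `h₂` of `…K2NamedJetsRunRemAt.EndpointGivenBR13SepCoPH_of_runShadowingJetsGivenB`,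
idea-4 `runs-given-b` ed.3) ⟹ the registered 2ᴮ″ (the window antecedent is discarded; = `…KKeyed.runRemAtSomeJetsK_of_runRemAtSomeJetsGivenB`). [folklore] -/
theorem runRemAtSomeJets_of_givenB
    (h : ∀ (F : T4Family) (θ : Node00.Stage13HParams F 2) (hP : θ.Provisos₁₃SepCoPH F 2),
      (θ.ZhUnity F 2 ∧ θ.SlotsNondegenerate₁₃ F 2) → θ.Admissible F 2 →
      B16.EndStatementBPrinted (Node00.datumOfRecord₁₃SepCoPH F 2 θ hP).C →
      ∃ κ : StepColourData, RunRemAt F κ θ hP θ.cβ) :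
    RunRemAtSomeJets :=
  fun F θ hP hU hθ hB _ => h F θ hP hU hθ hB

/-- BRIDGE «box ⟹ run»: v4's admissible-keyed BOX text `∀ F θ hP, θ.Admissible F 2 → ∃ κ, RemAt F κ θ hP θ.cβ` (skeleton v4 `RemAtSomeJets`; BN-F (N3) typing point) ⟹ the
registered 2ᴮ″ (`runRemAt_of_remAt`, p596574 :194; 2ᴮ″ is the WEAKER obligation). [folklore] -/
theorem runRemAtSomeJets_of_remAtAdm
    (h : ∀ (F : T4Family) (θ : Node00.Stage13HParams F 2) (hP : θ.Provisos₁₃SepCoPH F 2), θ.Admissible F 2 →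
      ∃ κ : StepColourData, RemAt F κ θ hP θ.cβ) :
    RunRemAtSomeJets := fun F θ hP _ hθ _ _ => by
  obtain ⟨κ, hRem⟩ := h F θ hP hθ
  exact ⟨κ, runRemAt_of_remAt F κ θ hP hRem⟩

/-! ## §4 (v1.1, APPEND-ONLY) The PINNED keying — CRIT-2 ROUND 4's recommended re-deal (b), concludable BY NAME

CRIT-2 ROUND 4 (`Cruxes/EndpointGivenBR13SepCoPH/CRIT-2-ROUND4-idea7.md`, 2026-08-28T03:26Z; idea-7 `CornerLimitSignSketch.lean` ed.4 §9): (1) AS DEALT, 1ᴬ has no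
β-side proof — under the crux's prefix «every κ that NAMES the record lies on the drift variety» is (D1) AT THE RECORD, record ∕ def-T content; (2) v6's two stubs are ONE
∃κ statement split along a seam (the identity of κ) neither owner sees; RE-DEAL (b): PIN `κ⋆ : ℕ → StepColourData` in the skeleton BEFORE θ and deal the θ-FREE (D1) stub
`∀ F, ∃ A, OneLoopDrift (stepBal 2 F.L) A (beta0OfJs F (κ⋆ F.L))` (the b2b row-(D1) binder at ONE pinned member) next to `… → RunRemAt F (κ⋆ F.L) θ hP θ.cβ` (def-T: the
identification at the pin) — = this seat's (R-a) keying (p593586 `EndpointGivenBR13SepCoPH_of_namedJets`, box letter, admissible prefix), now in the RUN edition under v6's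
full prefix.  The three theorems below take the pin as a PARAMETER (nothing here says which κ⋆ is print's — the β sub-cell's (P6) decision): the pinned pair ⟹ v6's
registered pair (so a pinned v7 loses nothing and the v6-keyed supplier roads stay valid) and ⟹ the crux decl BY NAME.  HONEST: hypothesis shapes; (D1) not discharged at
any colour datum; no pin chosen; K2⁷ OPEN. -/

/-- PINNED 2 ⟹ 2ᴮ″: the run letter AT A PIN `κ⋆ F.L` under the crux's prefix gives the registered 2ᴮ″ (the pin is the witness). [folklore] -/
theorem runRemAtSomeJets_of_pin (κ : ℕ → StepColourData)
    (hRun : ∀ (F : T4Family) (θ : Node00.Stage13HParams F 2) (hP : θ.Provisos₁₃SepCoPH F 2), (θ.ZhUnity F 2 ∧ θ.SlotsNondegenerate₁₃ F 2) → θ.Admissible F 2 →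
      B16.EndStatementBPrinted (Node00.datumOfRecord₁₃SepCoPH F 2 θ hP).C → Window13 F θ hP → RunRemAt F (κ F.L) θ hP θ.cβ) :
    RunRemAtSomeJets := fun F θ hP hU hθ hB hwin => ⟨κ F.L, hRun F θ hP hU hθ hB hwin⟩

/-- **★ PINNED (D1) + PINNED 2 ⟹ 1ᴬ** (the θ-FREE (D1) statement at the pin, `∀ F, ∃ A, OneLoopDrift (stepBal 2 F.L) A (beta0OfJs F (κ⋆ F.L))`, together with the run letter at
the pin, discharges v6's registered anchor-keyed (D1) stub): at a tuple carrying the crux's hypotheses the pin's scaled numbers ANCHOR the record (the anchor conjunct of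
`RunRemAt`), so every other anchoring colour datum has the pin's numbers (switch-κ, `d1AtAnchoredJets_of_someAnchoredDrift` ∕ `ScaleAnchor.eq_of_smul` at `θ.cβ ≠ 0`) and
drifts with them.  (= idea-7 §9 (9.3e) over the tree letters; CRIT-2: «v6's (D1) stub is discharged by {pinned (D1), pinned identification}».) [folklore] -/
theorem d1AtAnchoredJets_of_pin (κ : ℕ → StepColourData)
    (hD1 : ∀ F : T4Family, ∃ A : ℝ, OneLoopDrift (B12Normalization.stepBal 2 F.L) A (beta0OfJs F (κ F.L)))
    (hRun : ∀ (F : T4Family) (θ : Node00.Stage13HParams F 2) (hP : θ.Provisos₁₃SepCoPH F 2), (θ.ZhUnity F 2 ∧ θ.SlotsNondegenerate₁₃ F 2) → θ.Admissible F 2 →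
      B16.EndStatementBPrinted (Node00.datumOfRecord₁₃SepCoPH F 2 θ hP).C → Window13 F θ hP → RunRemAt F (κ F.L) θ hP θ.cβ) :
    D1AtAnchoredJets := by
  refine d1AtAnchoredJets_of_someAnchoredDrift fun F θ hP hU hθ hB hwin _ => ?_
  obtain ⟨-, -, -, -, -, -, hanch, -⟩ := hRun F θ hP hU hθ hB hwin
  obtain ⟨A, hdrift⟩ := hD1 F
  exact ⟨κ F.L, A, hanch, hdrift⟩

/-- **★★ THE PINNED PAIR ⟹ THE CRUX DECL BY NAME** (`Summit.QuantumFields.YangMills.Theses.BalabanUVNodes.EndpointGivenBR13SepCoPH`): CRIT-2 ROUND 4's re-deal (b) texts —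
the θ-free (D1) stub at the pin and the run letter at the pin under v6's full prefix — compose through §2's `EndpointGivenBR13SepCoPH_of_stubTexts` (equivalently, directly per
tuple by `endpointExistence_of_runRemAt_drift` at `κ⋆ F.L`).  A pinned v7 `{stub_d1AtPin13, stub_runRemPinnedJets13}` with a skeleton-level `def κ⋆` closes sorry-free by
`EndpointGivenBR13SepCoPH_of_pin κ⋆ stub_d1AtPin13 stub_runRemPinnedJets13`.  CONDITIONAL on the two displayed shapes; no pin chosen here; K2⁷ NOT closed; nothing of Bałaban
asserted. [cite: Balaban1987RG1, Thm 2 p.259 (first sentence), (1.3) p.260, (2.12)–(2.14) p.268 and (5.10) p.293] -/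
theorem EndpointGivenBR13SepCoPH_of_pin (κ : ℕ → StepColourData)
    (hD1 : ∀ F : T4Family, ∃ A : ℝ, OneLoopDrift (B12Normalization.stepBal 2 F.L) A (beta0OfJs F (κ F.L)))
    (hRun : ∀ (F : T4Family) (θ : Node00.Stage13HParams F 2) (hP : θ.Provisos₁₃SepCoPH F 2), (θ.ZhUnity F 2 ∧ θ.SlotsNondegenerate₁₃ F 2) → θ.Admissible F 2 →
      B16.EndStatementBPrinted (Node00.datumOfRecord₁₃SepCoPH F 2 θ hP).C → Window13 F θ hP → RunRemAt F (κ F.L) θ hP θ.cβ) :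
    Summit.QuantumFields.YangMills.Theses.BalabanUVNodes.EndpointGivenBR13SepCoPH :=
  EndpointGivenBR13SepCoPH_of_stubTexts (d1AtAnchoredJets_of_pin κ hD1 hRun) (runRemAtSomeJets_of_pin κ hRun)

end Summit.QuantumFields.YangMills.Theorems.BalabanUVNodesK2V6Defs

end
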